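import Summits.CriticalPhenomena.CardyFormulaZ2.Theses.UnionJackBeffara

/-!
# Route UnionJackBeffara — glue `LegsGiveTarget` (the two legs give the target)

Closes the support item `LegsGiveTarget` (stmt-CriticalPhenomena-14386) of route
`UnionJackBeffara` (sub-problem `CardyFormulaZ2`):
`UnionJackEndgame → UnionJackMorera → MixedInterpolation → Target`.

`Target` is the conjunction `UnionJackCardy ∧ MixedInterpolation`: Cardy's formula for the crude
`P_{1/2,1/2}` site-crossing probability of every conformal rectangle on the centred square lattice
`δG_s`, and flatness of Beffara's interpolation (`P_{1/2,1/2}` and `P_{1/2,0}` crossing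
probabilities differ by `o(1)`). Leg (I): `UnionJackEndgame` applied to `UnionJackMorera` is the
first conjunct; leg (II): `MixedInterpolation` is the second conjunct verbatim. The proof is pure
logic over the route's own declarations (the `let`-bound embedding `Z`, graph `G` and crossing
probability `P` are syntactically identical in all four declarations).

References: V. Beffara, *Is critical 2D percolation universal?* (2008), §3–§5; S. Smirnov,
C. R. Acad. Sci. Paris 333 (2001), Thm. 1; B. Bollobás, O. Riordan, *Percolation*, CUP (2006), Ch. 7.
-/

namespace Summit.CriticalPhenomena.CardyFormulaZ2.Theorems

open Summit.CriticalPhenomena.CardyFormulaZ2.Theses.UnionJackBeffara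

/-- **The two legs of route UnionJackBeffara give its target** (item `LegsGiveTarget`,
stmt-CriticalPhenomena-14386). If the Smirnov endgame on the centred square lattice holds
(`UnionJackEndgame : UnionJackMorera → UnionJackCardy`), Smirnov separating families exist on `G_s`
(`UnionJackMorera`), and Beffara's mixed interpolation is flat (`MixedInterpolation`), then
`Target = UnionJackCardy ∧ MixedInterpolation` holds: the first conjunct is `UnionJackEndgame`
applied to `UnionJackMorera`, the second is `MixedInterpolation` verbatim. -/
theorem unionJackBeffara_legsGiveTarget_proof :
    Summit.CriticalPhenomena.CardyFormulaZ2.Theses.UnionJackBeffara.LegsGiveTarget := by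
  unfold Summit.CriticalPhenomena.CardyFormulaZ2.Theses.UnionJackBeffara.LegsGiveTarget
  intro hE hM hI
  exact ⟨hE hM, hI⟩

end Summit.CriticalPhenomena.CardyFormulaZ2.Theorems
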